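/-
Copyright (c) 2026. All rights reserved.
Released under Apache 2.0 license as described in the file LICENSE.
-/
import Literature.AlgebraicGeometry.ComplexMultiplication.HyperellipticJacobianReflexFieldSeparation
import HarnessLib

/-!
# GGL 2024 Thm. 3.0 + Lemma 14 at a GENERIC COMPOSITE LEVEL `m = 4M`, `gcd(M, 15) = 1`:
# `End⁰(J_m) ≅ ℚ(i) × ∏_{d ∣ m odd, d ≠ 1} Mat₂(ℚ(ζ_d)) × ∏_{4 ∣ d ∣ m, d ≥ 8} Mat₂(ℚ(ζ_d − ζ_d⁻¹))`

Layer `Literature/AlgebraicGeometry/ComplexMultiplication`, namespace `…ComplexMultiplication.HyperellipticJacobian`; the family form of the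
assembly done at the levels `4p` (F13), `8p` (F21), now that `HyperellipticJacobianReflexFieldSeparation` (F23) separates ALL `Y_d`.  THEOREMS ONLY
(no definition, no named fact, no `sorry`, no instance).

## The print

A. Gallese, H. Goodson, D. Lombardo, arXiv:2405.20394 [GalleseGoodsonLombardo2024] (held `paper:arxiv-2405.20394`, p0012, p0015): THM. 3.0
«`J_m ∼ ∏_{d ∣ m, d ≠ 1,2} X_d`», (4) «`X_{2d} ∼ X_d`» (`d` odd), (5) «`X_d ∼ Y_d²` … CM by `ℚ(ζ_d − ζ_d⁻¹)`» (`4 ∣ d ∉ {20, 24, 60}`), the last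
statement, and §3.5 LEMMA 14 with the sentence following it.  When `4 ∣ m` and NONE of `12, 20` divides `m` (so none of `24, 60` either; i.e.
`m = 4M` with `gcd(M, 15) = 1`), the divisors `d ∉ {1, 2}` of `m` are: `4`; the pairs `{d, 2d}` over the odd divisors `d ≠ 1`; and the `d` with
`4 ∣ d ≥ 8`, none exceptional and none equal to `12` — so
`End⁰(J_m) ≅ ℚ(ζ_4) × ∏_{d ∣ m odd, d ≠ 1} Mat₂(ℚ(ζ_d)) × ∏_{4 ∣ d ∣ m, d ≥ 8} Mat₂(ℚ(ζ_d − ζ_d⁻¹))`, of dimension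
`2 + 4 Σ_{d odd} φ(d) + 2 Σ_{4 ∣ d} φ(d)`, and `2 dim J_m = 2 + 2 Σ_{d odd} φ(d) + Σ_{4 ∣ d} φ(d)`.

## The carrier (family form)

`![A₄, ⨁_i (A_i ⊕ A′_i), ⨁_j C_j]` over `Fin 3`: `A₄` a realisation of a type of `ℚ(ζ_4)`; for `i : Fin (k₁ + 1)`, realisations `A_i` of `Φ_{d_i}`
(`d_i ∣ M` odd, `d_i > 1`, distinct) and `A′_i` of `Φ_{2d_i}`; for `j : Fin k₂`, realisations `C_j` of `Φ_{e_j}` (`4 ∣ e_j ≥ 8`, `e_j ∉ {12, 20, 24, 60}`,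
distinct).  Reading: `d_i` = the odd divisors `≠ 1` of `m`, `e_j` = the divisors of `m` divisible by `4` other than `4`.

## What is proved

§0 `hom_to_biproduct_eq_zero`, `hom_from_biproduct_eq_zero`; §1 the `Y`-family: `hom_eq_zero_of_fourDvd_levels`,
**`nonempty_endAlgebra_biproduct_algEquiv_pi_fourDvd`** (`End⁰(⨁_j C_j) ≃ₐ[ℚ] ∏_j Mat₂(ℚ(ζ_{e_j} − ζ_{e_j}⁻¹))`), `finrank_endAlgebra_biproduct_fourDvd`;
§2 (`M > 1`) `hom_eq_zero_blocks_genericComposite`, **`nonempty_endAlgebra_algEquiv_genericComposite`**, **`finrank_endAlgebra_genericComposite`**;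
§3 (`M = 1`, `m = 2^k`, `k ≥ 3`, carrier `![A₄, ⨁_j C_j]`) `hom_eq_zero_blocks_twoPower`, **`nonempty_endAlgebra_algEquiv_twoPower`**
(`End⁰(J_{2^k}) ≃ₐ[ℚ] ℚ(ζ_4) × ∏_{8 ≤ e ∣ 2^k} Mat₂(ℚ(ζ_e − ζ_e⁻¹))`), **`finrank_endAlgebra_twoPower`** (`2^{k+1} − 6`; `g = 2^{k−1} − 1`).

## Honest column ∕ NOT here

The curve; levels divisible by `12` (the block `X_4 ⊕ X_{12} ∼ X_4³`, F15) or by `20` (the exceptional blocks, F16 ∕ F18 ∕ F20 ∕ F22); the closed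
forms `Σ φ = …` of the sums (Gauss).  `HC_CM` is not touched.

## References

* [GalleseGoodsonLombardo2024] arXiv:2405.20394 — §3 Thm. 3.0 ((4), (5), last statement), §3.5 Lemma 14 and the sentence following it.
* [MumfordAV1970] D. Mumford — §19 Thm. 3 Cor. 1–2, p. 174.
* [Shimura1998] G. Shimura — §5.1 Prop. 3, Prop. 6, §8.3 Prop. 28.
* [MilneCM2006] J. S. Milne — Ch. I §1 Prop. 1.18 (c), §3 Prop. 3.13.

## Provenance

Cell `pub-hodgecm2` (COR-CM), KEPT Literature lane `lit-deligne-3` gen 52 (claim GGL24-GENERIC-COMPOSITE; count-neutral, own lane).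
-/

noncomputable section

open CategoryTheory CategoryTheory.Limits NumberField Module

namespace Literature.AlgebraicGeometry.ComplexMultiplication

open Literature.AlgebraicGeometry.Motives
open Literature.AlgebraicGeometry.HodgeTheory (complexBetti)
open Literature.NumberTheory.ComplexMultiplication

namespace HyperellipticJacobian

open Literature.AlgebraicGeometry.Pohlmann1968 Literature.AlgebraicGeometry.Pohlmann1968.Cyclotomic

/-! ## §0 Bookkeeping: homomorphisms into ∕ out of a biproduct from their components -/

section Plumbing

/-- A homomorphism INTO a biproduct vanishes if all its components do. [cite: MumfordAV1970, §19 (p. 174)] -/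
theorem hom_to_biproduct_eq_zero {κ : Type} [Fintype κ] [DecidableEq κ] {B : κ → AbelianVariety ℂ} {Z : AbelianVariety ℂ}
    (h : ∀ l, ∀ u : Z ⟶ B l, u = 0) (f : Z ⟶ ⨁ B) : f = 0 :=
  biproduct.hom_ext _ _ fun l => by rw [Limits.zero_comp]; exact h l _

/-- A homomorphism OUT OF a biproduct vanishes if all its components do. [cite: MumfordAV1970, §19 (p. 174)] -/
theorem hom_from_biproduct_eq_zero {κ : Type} [Fintype κ] [DecidableEq κ] {B : κ → AbelianVariety ℂ} {Z : AbelianVariety ℂ}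
    (h : ∀ l, ∀ u : B l ⟶ Z, u = 0) (f : (⨁ B) ⟶ Z) : f = 0 :=
  biproduct.hom_ext' _ _ fun l => by rw [Limits.comp_zero]; exact h l _

/-- The product of three algebras indexed by `Fin 3`. [folklore] -/
private theorem nonempty_pi_fin_three_algEquiv_prod_g (T : Fin 3 → Type) [∀ i, Ring (T i)] [∀ i, Algebra ℚ (T i)] :
    Nonempty ((∀ i, T i) ≃ₐ[ℚ] T 0 × (T 1 × T 2)) := by
  refine ⟨AlgEquiv.ofBijective
    ((Pi.evalAlgHom ℚ T 0).prod ((Pi.evalAlgHom ℚ T 1).prod (Pi.evalAlgHom ℚ T 2))) ⟨fun f g h => ?_, fun x => ?_⟩⟩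
  · simp only [AlgHom.prod_apply, Pi.evalAlgHom_apply, Prod.mk.injEq] at h
    funext i
    match i with
    | ⟨0, _⟩ => exact h.1
    | ⟨1, _⟩ => exact h.2.1
    | ⟨2, _⟩ => exact h.2.2
  · exact ⟨Fin.cons x.1 (Fin.cons x.2.1 (Fin.cons x.2.2 finZeroElim)), rfl⟩

end Plumbing

/-! ## §1 The `Y`-family: `End⁰(⨁_j C_j) ≅ ∏_j Mat₂(ℚ(ζ_{e_j} − ζ_{e_j}⁻¹))` for distinct non-exceptional `4 ∣ e_j ≥ 8` -/

section FourDvdFamily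

variable {k₂ : ℕ} {lev₂ : Fin k₂ → ℕ} [∀ j, NeZero (lev₂ j)] {F : Fin k₂ → Type} [∀ j, Field (F j)] [∀ j, NumberField (F j)]
  [∀ j, IsCyclotomicExtension {lev₂ j} ℚ (F j)] {Ψ : ∀ j, CMType (F j)} {C : Fin k₂ → AbelianVariety ℂ}
  {ιC : ∀ j, 𝓞 (F j) →+* End (C j)} {θC : ∀ j, F j →+* Module.End ℂ (complexBetti (C j).X 1)}

/-- **The `X_e` with `4 ∣ e ≥ 8` non-exceptional and DISTINCT levels are pairwise orthogonal** (F23 `orthogonal_fourDvd_of_ne`).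
[cite: GalleseGoodsonLombardo2024, §3 Thm. 3.0 (last statement)] [cite: MilneCM2006, Ch. I §3 Prop. 3.13] -/
theorem hom_eq_zero_of_fourDvd_levels (h4 : ∀ j, 4 ∣ lev₂ j) (h8 : ∀ j, 8 ≤ lev₂ j) (h20 : ∀ j, lev₂ j ≠ 20) (h24 : ∀ j, lev₂ j ≠ 24)
    (h60 : ∀ j, lev₂ j ≠ 60) (hinj : Function.Injective lev₂)
    (hΨ : ∀ j (σ : F j →+* ℂ), σ ∈ (Ψ j).1 ↔ 2 * (expOf (lev₂ j) (F j) σ).val < lev₂ j)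
    (hC : ∀ j, IsCMTypeRealisation (Ψ j) (C j) (ιC j) (θC j)) {i j : Fin k₂} (hij : i ≠ j) (f : C i ⟶ C j) : f = 0 :=
  (orthogonal_fourDvd_of_ne (h4 i) (h8 i) (h20 i) (h24 i) (h60 i) (hΨ i) (hC i) (h4 j) (h8 j) (h20 j) (h24 j) (h60 j) (hΨ j) (hC j)
    (fun h => hij (hinj h))).1 f

/-- **`End⁰(⨁_j C_j) ≃ₐ[ℚ] ∏_j Mat₂(ℚ(ζ_{e_j} − ζ_{e_j}⁻¹))`** for distinct non-exceptional levels `4 ∣ e_j ≥ 8` (orthogonal family, Mumford §19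
Cor. 2; Lemma 14 (2) on each factor). [cite: GalleseGoodsonLombardo2024, §3.5 Lemma 14 (2) and the sentence following it; §3 Thm. 3.0 (5), last statement]
[cite: MumfordAV1970, §19 Cor. 2 of Thm. 3 and p. 174] [cite: Shimura1998, §5.1 Prop. 6] -/
theorem nonempty_endAlgebra_biproduct_algEquiv_pi_fourDvd (h4 : ∀ j, 4 ∣ lev₂ j) (h8 : ∀ j, 8 ≤ lev₂ j) (h20 : ∀ j, lev₂ j ≠ 20)
    (h24 : ∀ j, lev₂ j ≠ 24) (h60 : ∀ j, lev₂ j ≠ 60) (hinj : Function.Injective lev₂)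
    (hΨ : ∀ j (σ : F j →+* ℂ), σ ∈ (Ψ j).1 ↔ 2 * (expOf (lev₂ j) (F j) σ).val < lev₂ j)
    (hC : ∀ j, IsCMTypeRealisation (Ψ j) (C j) (ιC j) (θC j)) :
    Nonempty ((⨁ C).endAlgebra ≃ₐ[ℚ]
      ∀ j, Matrix (Fin 2) (Fin 2) (IntermediateField.adjoin ℚ {zetaOf (lev₂ j) (F j) - (zetaOf (lev₂ j) (F j))⁻¹})) := by
  classical
  obtain ⟨e, -⟩ := AbelianVariety.nonempty_algEquiv_endAlgebra_biproduct_pi (A := C)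
    (fun i j hij f => hom_eq_zero_of_fourDvd_levels h4 h8 h20 h24 h60 hinj hΨ hC hij f)
  have e' : ∀ j, (C j).endAlgebra ≃ₐ[ℚ]
      Matrix (Fin 2) (Fin 2) (IntermediateField.adjoin ℚ {zetaOf (lev₂ j) (F j) - (zetaOf (lev₂ j) (F j))⁻¹}) := fun j =>
    (Classical.choice (nonempty_matrix_two_algEquiv_endAlgebra_of_four_dvd (h4 j) (h8 j) (h20 j) (h24 j) (h60 j) (Ψ j) (hΨ j)
      (hC j)).2.1).symm
  exact ⟨e.trans (AlgEquiv.piCongrRight e')⟩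

/-- **`dim_ℚ End⁰(⨁_j C_j) = 2 Σ_j φ(e_j)` and `2 dim(⨁_j C_j) = Σ_j φ(e_j)`** (`dim_ℚ Mat₂(ℚ(ζ_e − ζ_e⁻¹)) = 4·φ(e)/2`, `dim X_e = φ(e)/2`).
[cite: GalleseGoodsonLombardo2024, §3 Thm. 3.0 («dim X_d = φ(d)/2») and §3.5 Lemma 14 (2)] [cite: MumfordAV1970, §19 Cor. 2 of Thm. 3] -/
theorem finrank_endAlgebra_biproduct_fourDvd (h4 : ∀ j, 4 ∣ lev₂ j) (h8 : ∀ j, 8 ≤ lev₂ j) (h20 : ∀ j, lev₂ j ≠ 20)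
    (h24 : ∀ j, lev₂ j ≠ 24) (h60 : ∀ j, lev₂ j ≠ 60) (hinj : Function.Injective lev₂)
    (hΨ : ∀ j (σ : F j →+* ℂ), σ ∈ (Ψ j).1 ↔ 2 * (expOf (lev₂ j) (F j) σ).val < lev₂ j)
    (hC : ∀ j, IsCMTypeRealisation (Ψ j) (C j) (ιC j) (θC j)) :
    finrank ℚ (⨁ C).endAlgebra = 2 * ∑ j, Nat.totient (lev₂ j) ∧ 2 * (⨁ C).dim = ∑ j, Nat.totient (lev₂ j) := by
  classical
  have hFj : ∀ j, 2 * finrank ℚ (IntermediateField.adjoin ℚ {zetaOf (lev₂ j) (F j) - (zetaOf (lev₂ j) (F j))⁻¹}) =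
      Nat.totient (lev₂ j) := fun j => by
    obtain ⟨K₁, Φ₁, h₁, hp₁, -⟩ := exists_primitive_inducedCMType_index_two_of_four_dvd (h4 j) (h8 j) (h20 j) (h24 j) (h60 j) (Ψ j) (hΨ j)
    obtain ⟨-, -, -, -, -, -, -, hdeg, hK₁⟩ :=
      eq_fixedField_and_eq_adjoin_of_primitive_of_four_dvd (h4 j) (h8 j) (h20 j) (h24 j) (h60 j) (Ψ j) (hΨ j) Φ₁ h₁ hp₁
    rw [← hK₁]
    exact hdeg
  refine ⟨?_, ?_⟩
  · obtain ⟨e⟩ := nonempty_endAlgebra_biproduct_algEquiv_pi_fourDvd h4 h8 h20 h24 h60 hinj hΨ hC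
    haveI : ∀ j, FiniteDimensional ℚ (IntermediateField.adjoin ℚ {zetaOf (lev₂ j) (F j) - (zetaOf (lev₂ j) (F j))⁻¹}) := fun j =>
      IntermediateField.finiteDimensional_left _
    haveI : ∀ j, Module.Finite ℚ (Matrix (Fin 2) (Fin 2)
        (IntermediateField.adjoin ℚ {zetaOf (lev₂ j) (F j) - (zetaOf (lev₂ j) (F j))⁻¹})) := fun j => Module.Finite.matrix
    rw [e.toLinearEquiv.finrank_eq, Module.finrank_pi_fintype, Finset.mul_sum]
    refine Finset.sum_congr rfl fun j _ => ?_
    rw [Module.finrank_matrix, Fintype.card_fin, ← hFj j]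
    ring
  · have hdim : ∀ j, 2 * (C j).dim = Nat.totient (lev₂ j) := fun j => by
      have h1' : (C j).dim = finrank ℚ (F j) / 2 := Motives.schemeDim_eq_holds (hC j).1
      have h2 := CMTypeLattice.two_mul_card_eq_finrank (Ψ j)
      rw [← finrank_eq_totient (lev₂ j) (F j)]
      omega
    rw [AbelianVariety.dim_biproduct C, Finset.mul_sum]
    exact Finset.sum_congr rfl fun j _ => hdim j

end FourDvdFamily

/-! ## §2 The generic composite level: `X_4`, the pairs `X_d ⊕ X_{2d}` (`d ∣ m` odd), the `X_e` (`4 ∣ e ∣ m`, `e ≥ 8`) -/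

section GenericComposite

variable {K₄ : Type} [Field K₄] [NumberField K₄] [IsCyclotomicExtension {4} ℚ K₄] {Φ₄ : CMType K₄}
  {A₄ : AbelianVariety ℂ} {ι₄ : 𝓞 K₄ →+* End A₄} {θ₄ : K₄ →+* Module.End ℂ (complexBetti A₄.X 1)}
  {k₁ : ℕ} {lev₁ : Fin (k₁ + 1) → ℕ} [∀ i, NeZero (lev₁ i)] [∀ i, NeZero (2 * lev₁ i)]
  {K : Fin (k₁ + 1) → Type} [∀ i, Field (K i)] [∀ i, NumberField (K i)] [∀ i, IsCyclotomicExtension {lev₁ i} ℚ (K i)]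
  {L : Fin (k₁ + 1) → Type} [∀ i, Field (L i)] [∀ i, NumberField (L i)] [∀ i, IsCyclotomicExtension {2 * lev₁ i} ℚ (L i)]
  {Φ : ∀ i, CMType (K i)} {ΦL : ∀ i, CMType (L i)}
  {A A' : Fin (k₁ + 1) → AbelianVariety ℂ} {ι : ∀ i, 𝓞 (K i) →+* End (A i)}
  {θ : ∀ i, K i →+* Module.End ℂ (complexBetti (A i).X 1)} {ι' : ∀ i, 𝓞 (L i) →+* End (A' i)}
  {θ' : ∀ i, L i →+* Module.End ℂ (complexBetti (A' i).X 1)} {M : ℕ}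
  {k₂ : ℕ} {lev₂ : Fin k₂ → ℕ} [∀ j, NeZero (lev₂ j)] {F : Fin k₂ → Type} [∀ j, Field (F j)] [∀ j, NumberField (F j)]
  [∀ j, IsCyclotomicExtension {lev₂ j} ℚ (F j)] {Ψ : ∀ j, CMType (F j)} {C : Fin k₂ → AbelianVariety ℂ}
  {ιC : ∀ j, 𝓞 (F j) →+* End (C j)} {θC : ∀ j, F j →+* Module.End ℂ (complexBetti (C j).X 1)}

omit [∀ i, NeZero (lev₁ i)] [∀ i, NeZero (2 * lev₁ i)] in
/-- Divisors `d_i > 1` of an odd `M` are odd and at least `3`. [folklore] -/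
private theorem odd_and_three_le' (hodd : Odd M) (hdvd : ∀ i, lev₁ i ∣ M) (h1 : ∀ i, 1 < lev₁ i) (i : Fin (k₁ + 1)) :
    Odd (lev₁ i) ∧ 3 ≤ lev₁ i := by
  have ho : Odd (lev₁ i) := hodd.of_dvd_nat (hdvd i)
  refine ⟨ho, ?_⟩
  obtain ⟨r, hr⟩ := ho
  have := h1 i
  omega

/-- **The three parts `X_4`, `⨁_i (X_{d_i} ⊕ X_{2d_i})`, `⨁_j X_{e_j}` of `J_m` (`m = 4M`, `12 ∤ m`, `20 ∤ m`) are pairwise orthogonal**: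
`X_4 ⟂ X_{d}, X_{2d}` (`d` odd, F12), `X_4 ⟂ X_e` (`e ≠ 12`, F23), `X_d, X_{2d} ⟂ X_e` (F12) — assembled componentwise.
[cite: GalleseGoodsonLombardo2024, §3 Thm. 3.0 (last statement)] [cite: MilneCM2006, Ch. I §3 Prop. 3.13] -/
theorem hom_eq_zero_blocks_genericComposite (hodd : Odd M) (hdvd : ∀ i, lev₁ i ∣ M) (h1 : ∀ i, 1 < lev₁ i)
    (hΦ : ∀ i (σ : K i →+* ℂ), σ ∈ (Φ i).1 ↔ 2 * (expOf (lev₁ i) (K i) σ).val < lev₁ i)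
    (hΦL : ∀ i (σ : L i →+* ℂ), σ ∈ (ΦL i).1 ↔ 2 * (expOf (2 * lev₁ i) (L i) σ).val < 2 * lev₁ i)
    (hA : ∀ i, IsCMTypeRealisation (Φ i) (A i) (ι i) (θ i)) (hA' : ∀ i, IsCMTypeRealisation (ΦL i) (A' i) (ι' i) (θ' i))
    (hA₄ : IsCMTypeRealisation Φ₄ A₄ ι₄ θ₄)
    (h4 : ∀ j, 4 ∣ lev₂ j) (h8 : ∀ j, 8 ≤ lev₂ j) (h12 : ∀ j, lev₂ j ≠ 12) (h20 : ∀ j, lev₂ j ≠ 20) (h24 : ∀ j, lev₂ j ≠ 24)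
    (h60 : ∀ j, lev₂ j ≠ 60) (hΨ : ∀ j (σ : F j →+* ℂ), σ ∈ (Ψ j).1 ↔ 2 * (expOf (lev₂ j) (F j) σ).val < lev₂ j)
    (hC : ∀ j, IsCMTypeRealisation (Ψ j) (C j) (ιC j) (θC j)) :
    ∀ a b : Fin 3, a ≠ b →
      ∀ f : (![A₄, ⨁ fun i => ⨁ fun l : Fin 2 => (![A i, A' i] : Fin 2 → AbelianVariety ℂ) l, ⨁ C] : Fin 3 → AbelianVariety ℂ) a ⟶
        (![A₄, ⨁ fun i => ⨁ fun l : Fin 2 => (![A i, A' i] : Fin 2 → AbelianVariety ℂ) l, ⨁ C] : Fin 3 → AbelianVariety ℂ) b, f = 0 := by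
  classical
  have ho : ∀ i, Odd (lev₁ i) ∧ 3 ≤ lev₁ i := odd_and_three_le' hodd hdvd h1
  -- the elementary relations
  have o4A : ∀ i, (∀ u : A i ⟶ A₄, u = 0) ∧ (∀ v : A₄ ⟶ A i, v = 0) := fun i =>
    let h := orthogonal_odd_four (Φ' := Φ₄) (ho i).1 (ho i).2 (hΦ i) (hA i) hA₄
    ⟨h.1, h.2.1⟩
  have o4A' : ∀ i, (∀ u : A' i ⟶ A₄, u = 0) ∧ (∀ v : A₄ ⟶ A' i, v = 0) := fun i =>
    let h := orthogonal_twiceOdd_four (Φ' := Φ₄) (ho i).1 (ho i).2 (hΦL i) (hA' i) hA₄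
    ⟨h.1, h.2.1⟩
  have o4C : ∀ j, (∀ u : A₄ ⟶ C j, u = 0) ∧ (∀ v : C j ⟶ A₄, v = 0) := fun j =>
    let h := orthogonal_four_fourDvd_of_ne_twelve hA₄ (h4 j) (h8 j) (h12 j) (h20 j) (h24 j) (h60 j) (hΨ j) (hC j)
    ⟨h.1, h.2.1⟩
  have oAC : ∀ i j, (∀ u : A i ⟶ C j, u = 0) ∧ (∀ v : C j ⟶ A i, v = 0) := fun i j =>
    let h := orthogonal_odd_fourDvd (ho i).1 (ho i).2 (hΦ i) (hA i) (h4 j) (h8 j) (h20 j) (h24 j) (h60 j) (hΨ j) (hC j)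
    ⟨h.1, h.2.1⟩
  have oA'C : ∀ i j, (∀ u : A' i ⟶ C j, u = 0) ∧ (∀ v : C j ⟶ A' i, v = 0) := fun i j =>
    let h := orthogonal_twiceOdd_fourDvd (ho i).1 (ho i).2 (hΦL i) (hA' i) (h4 j) (h8 j) (h20 j) (h24 j) (h60 j) (hΨ j) (hC j)
    ⟨h.1, h.2.1⟩
  -- block-level relations
  have b01 : (∀ u : A₄ ⟶ ⨁ fun i => ⨁ fun l : Fin 2 => (![A i, A' i] : Fin 2 → AbelianVariety ℂ) l, u = 0) ∧
      (∀ v : (⨁ fun i => ⨁ fun l : Fin 2 => (![A i, A' i] : Fin 2 → AbelianVariety ℂ) l) ⟶ A₄, v = 0) :=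
    ⟨fun u => hom_to_biproduct_eq_zero (fun i w => hom_to_pair_eq_zero (o4A i).2 (o4A' i).2 w) u,
      fun v => hom_from_biproduct_eq_zero (fun i w => hom_from_pair_eq_zero (o4A i).1 (o4A' i).1 w) v⟩
  have b02 : (∀ u : A₄ ⟶ ⨁ C, u = 0) ∧ (∀ v : (⨁ C) ⟶ A₄, v = 0) :=
    ⟨fun u => hom_to_biproduct_eq_zero (fun j w => (o4C j).1 w) u, fun v => hom_from_biproduct_eq_zero (fun j w => (o4C j).2 w) v⟩
  have b12 : (∀ u : (⨁ fun i => ⨁ fun l : Fin 2 => (![A i, A' i] : Fin 2 → AbelianVariety ℂ) l) ⟶ ⨁ C, u = 0) ∧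
      (∀ v : (⨁ C) ⟶ ⨁ fun i => ⨁ fun l : Fin 2 => (![A i, A' i] : Fin 2 → AbelianVariety ℂ) l, v = 0) :=
    ⟨fun u => AbelianVariety.hom_biproduct_eq_zero (fun i j w => hom_from_pair_eq_zero (oAC i j).1 (oA'C i j).1 w) u,
      fun v => AbelianVariety.hom_biproduct_eq_zero (fun j i w => hom_to_pair_eq_zero (oAC i j).2 (oA'C i j).2 w) v⟩
  -- assemble
  have g1 := hom_eq_zero_vecCons (X := ⨁ fun i => ⨁ fun l : Fin 2 => (![A i, A' i] : Fin 2 → AbelianVariety ℂ) l)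
    (F := (![⨁ C] : Fin 1 → AbelianVariety ℂ)) (Fin.cons b12 finZeroElim) hom_eq_zero_of_fin_one
  exact hom_eq_zero_vecCons (X := A₄)
    (F := (![⨁ fun i => ⨁ fun l : Fin 2 => (![A i, A' i] : Fin 2 → AbelianVariety ℂ) l, ⨁ C] : Fin 2 → AbelianVariety ℂ))
    (Fin.cons b01 (Fin.cons b02 finZeroElim)) g1

omit [IsCyclotomicExtension {4} ℚ K₄] in
/-- `[ℚ(ζ_4) : ℚ] = 2`. [folklore] -/
private theorem finrank_eq_two_four_g [IsCyclotomicExtension {4} ℚ K₄] : finrank ℚ K₄ = 2 := by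
  rw [finrank_eq_totient 4 K₄]
  decide +kernel

/-- **GGL THM. 3.0 + LEMMA 14 at a generic composite level `m = 4M`, `12 ∤ m`, `20 ∤ m` (family form):
`End⁰(J_m) ≃ₐ[ℚ] ℚ(ζ_4) × ((∏_i Mat₂(ℚ(ζ_{d_i}))) × (∏_j Mat₂(ℚ(ζ_{e_j} − ζ_{e_j}⁻¹))))`** on the carrier `![A₄, ⨁_i (A_i ⊕ A′_i), ⨁_j C_j]` — the
three parts are pairwise orthogonal (§2), `End⁰(A₄) = ℚ(ζ_4)` (every type of `ℚ(i)` is primitive), `End⁰(⨁_i (A_i ⊕ A′_i)) ≅ ∏_i Mat₂(ℚ(ζ_{d_i}))`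
(F11: `X_{2d} ∼ X_d`, orthogonal odd levels, Lemma 14 first case), `End⁰(⨁_j C_j) ≅ ∏_j Mat₂(ℚ(ζ_{e_j} − ζ_{e_j}⁻¹))` (§1).
[cite: GalleseGoodsonLombardo2024, §3.5 Lemma 14 and the sentence following it; §3 Thm. 3.0 (4), (5), last statement]
[cite: MumfordAV1970, §19 Cor. 2 of Thm. 3 and p. 174] [cite: Shimura1998, §5.1 Prop. 3 (proof) and Prop. 6] -/
theorem nonempty_endAlgebra_algEquiv_genericComposite [NeZero M] (hodd : Odd M) (hdvd : ∀ i, lev₁ i ∣ M) (hinj₁ : Function.Injective lev₁)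
    (h1 : ∀ i, 1 < lev₁ i) (hΦ : ∀ i (σ : K i →+* ℂ), σ ∈ (Φ i).1 ↔ 2 * (expOf (lev₁ i) (K i) σ).val < lev₁ i)
    (hΦL : ∀ i (σ : L i →+* ℂ), σ ∈ (ΦL i).1 ↔ 2 * (expOf (2 * lev₁ i) (L i) σ).val < 2 * lev₁ i)
    (hA : ∀ i, IsCMTypeRealisation (Φ i) (A i) (ι i) (θ i)) (hA' : ∀ i, IsCMTypeRealisation (ΦL i) (A' i) (ι' i) (θ' i))
    (hA₄ : IsCMTypeRealisation Φ₄ A₄ ι₄ θ₄)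
    (h4 : ∀ j, 4 ∣ lev₂ j) (h8 : ∀ j, 8 ≤ lev₂ j) (h12 : ∀ j, lev₂ j ≠ 12) (h20 : ∀ j, lev₂ j ≠ 20) (h24 : ∀ j, lev₂ j ≠ 24)
    (h60 : ∀ j, lev₂ j ≠ 60) (hinj₂ : Function.Injective lev₂)
    (hΨ : ∀ j (σ : F j →+* ℂ), σ ∈ (Ψ j).1 ↔ 2 * (expOf (lev₂ j) (F j) σ).val < lev₂ j)
    (hC : ∀ j, IsCMTypeRealisation (Ψ j) (C j) (ιC j) (θC j)) :
    Nonempty ((⨁ fun a : Fin 3 =>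
        (![A₄, ⨁ fun i => ⨁ fun l : Fin 2 => (![A i, A' i] : Fin 2 → AbelianVariety ℂ) l, ⨁ C] : Fin 3 → AbelianVariety ℂ) a).endAlgebra ≃ₐ[ℚ]
      K₄ × ((∀ i, Matrix (Fin 2) (Fin 2) (K i)) ×
        (∀ j, Matrix (Fin 2) (Fin 2) (IntermediateField.adjoin ℚ {zetaOf (lev₂ j) (F j) - (zetaOf (lev₂ j) (F j))⁻¹})))) := by
  classical
  obtain ⟨E, -⟩ := AbelianVariety.nonempty_algEquiv_endAlgebra_biproduct_pi
    (A := fun a : Fin 3 => (![A₄, ⨁ fun i => ⨁ fun l : Fin 2 => (![A i, A' i] : Fin 2 → AbelianVariety ℂ) l, ⨁ C] :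
      Fin 3 → AbelianVariety ℂ) a)
    (hom_eq_zero_blocks_genericComposite hodd hdvd h1 hΦ hΦL hA hA' hA₄ h4 h8 h12 h20 h24 h60 hΨ hC)
  obtain ⟨P⟩ := nonempty_pi_fin_three_algEquiv_prod_g
    (fun a : Fin 3 => ((![A₄, ⨁ fun i => ⨁ fun l : Fin 2 => (![A i, A' i] : Fin 2 → AbelianVariety ℂ) l, ⨁ C] :
      Fin 3 → AbelianVariety ℂ) a).endAlgebra)
  obtain ⟨e₀⟩ : Nonempty (A₄.endAlgebra ≃ₐ[ℚ] K₄) :=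
    hA₄.nonempty_endAlgebra_algEquiv_of_primitive (CMTypeLattice.primitive_of_finrank_eq_two Φ₄ finrank_eq_two_four_g)
  obtain ⟨e₁⟩ := nonempty_endAlgebra_algEquiv_pi_matrix_twiceOdd hodd hdvd hinj₁ h1 hΦ hΦL hA hA'
  obtain ⟨e₂⟩ := nonempty_endAlgebra_biproduct_algEquiv_pi_fourDvd h4 h8 h20 h24 h60 hinj₂ hΨ hC
  exact ⟨(E.trans P).trans (AlgEquiv.prodCongr e₀ (AlgEquiv.prodCongr e₁ e₂))⟩

/-- **Dimension count at a generic composite level: `dim_ℚ End⁰(J) = 2 + 4 Σ_i φ(d_i) + 2 Σ_j φ(e_j)` and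
`2 dim J = 2 + 2 Σ_i φ(d_i) + Σ_j φ(e_j)`** (for `J_m` with all divisors present: `2 + 4(M₀ − 1) + …`, `M₀` the odd part of `m`).
[cite: GalleseGoodsonLombardo2024, §3 Thm. 3.0 («dim X_d = φ(d)/2») and §3.5 Lemma 14] [cite: MumfordAV1970, §19 Cor. 2 of Thm. 3] -/
theorem finrank_endAlgebra_genericComposite [NeZero M] (hodd : Odd M) (hdvd : ∀ i, lev₁ i ∣ M) (hinj₁ : Function.Injective lev₁)
    (h1 : ∀ i, 1 < lev₁ i) (hΦ : ∀ i (σ : K i →+* ℂ), σ ∈ (Φ i).1 ↔ 2 * (expOf (lev₁ i) (K i) σ).val < lev₁ i)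
    (hΦL : ∀ i (σ : L i →+* ℂ), σ ∈ (ΦL i).1 ↔ 2 * (expOf (2 * lev₁ i) (L i) σ).val < 2 * lev₁ i)
    (hA : ∀ i, IsCMTypeRealisation (Φ i) (A i) (ι i) (θ i)) (hA' : ∀ i, IsCMTypeRealisation (ΦL i) (A' i) (ι' i) (θ' i))
    (hA₄ : IsCMTypeRealisation Φ₄ A₄ ι₄ θ₄)
    (h4 : ∀ j, 4 ∣ lev₂ j) (h8 : ∀ j, 8 ≤ lev₂ j) (h12 : ∀ j, lev₂ j ≠ 12) (h20 : ∀ j, lev₂ j ≠ 20) (h24 : ∀ j, lev₂ j ≠ 24)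
    (h60 : ∀ j, lev₂ j ≠ 60) (hinj₂ : Function.Injective lev₂)
    (hΨ : ∀ j (σ : F j →+* ℂ), σ ∈ (Ψ j).1 ↔ 2 * (expOf (lev₂ j) (F j) σ).val < lev₂ j)
    (hC : ∀ j, IsCMTypeRealisation (Ψ j) (C j) (ιC j) (θC j)) :
    finrank ℚ (⨁ fun a : Fin 3 =>
        (![A₄, ⨁ fun i => ⨁ fun l : Fin 2 => (![A i, A' i] : Fin 2 → AbelianVariety ℂ) l, ⨁ C] : Fin 3 → AbelianVariety ℂ) a).endAlgebra =
      2 + 4 * ∑ i, Nat.totient (lev₁ i) + 2 * ∑ j, Nat.totient (lev₂ j) ∧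
    2 * (⨁ fun a : Fin 3 =>
        (![A₄, ⨁ fun i => ⨁ fun l : Fin 2 => (![A i, A' i] : Fin 2 → AbelianVariety ℂ) l, ⨁ C] : Fin 3 → AbelianVariety ℂ) a).dim =
      2 + 2 * ∑ i, Nat.totient (lev₁ i) + ∑ j, Nat.totient (lev₂ j) := by
  classical
  have ho : ∀ i, Odd (lev₁ i) ∧ 3 ≤ lev₁ i := odd_and_three_le' hodd hdvd h1
  obtain ⟨hfrC, hdimC⟩ := finrank_endAlgebra_biproduct_fourDvd h4 h8 h20 h24 h60 hinj₂ hΨ hC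
  have hK : ∀ i, finrank ℚ (K i) = Nat.totient (lev₁ i) := fun i => finrank_eq_totient (lev₁ i) (K i)
  refine ⟨?_, ?_⟩
  · obtain ⟨e⟩ := nonempty_endAlgebra_algEquiv_genericComposite hodd hdvd hinj₁ h1 hΦ hΦL hA hA' hA₄ h4 h8 h12 h20 h24 h60 hinj₂ hΨ hC
    obtain ⟨e₂⟩ := nonempty_endAlgebra_biproduct_algEquiv_pi_fourDvd h4 h8 h20 h24 h60 hinj₂ hΨ hC
    haveI : ∀ j, FiniteDimensional ℚ (IntermediateField.adjoin ℚ {zetaOf (lev₂ j) (F j) - (zetaOf (lev₂ j) (F j))⁻¹}) := fun j =>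
      IntermediateField.finiteDimensional_left _
    haveI : ∀ j, Module.Finite ℚ (Matrix (Fin 2) (Fin 2)
        (IntermediateField.adjoin ℚ {zetaOf (lev₂ j) (F j) - (zetaOf (lev₂ j) (F j))⁻¹})) := fun j => Module.Finite.matrix
    haveI : ∀ j, Module.Free ℚ (Matrix (Fin 2) (Fin 2)
        (IntermediateField.adjoin ℚ {zetaOf (lev₂ j) (F j) - (zetaOf (lev₂ j) (F j))⁻¹})) := fun j => inferInstance
    haveI : ∀ i, Module.Finite ℚ (Matrix (Fin 2) (Fin 2) (K i)) := fun i => Module.Finite.matrix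
    haveI : ∀ i, Module.Free ℚ (Matrix (Fin 2) (Fin 2) (K i)) := fun i => inferInstance
    haveI : Module.Finite ℚ (∀ j, Matrix (Fin 2) (Fin 2)
        (IntermediateField.adjoin ℚ {zetaOf (lev₂ j) (F j) - (zetaOf (lev₂ j) (F j))⁻¹})) := inferInstance
    haveI : Module.Free ℚ (∀ j, Matrix (Fin 2) (Fin 2)
        (IntermediateField.adjoin ℚ {zetaOf (lev₂ j) (F j) - (zetaOf (lev₂ j) (F j))⁻¹})) := inferInstance
    haveI : Module.Finite ℚ (∀ i, Matrix (Fin 2) (Fin 2) (K i)) := inferInstance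
    haveI : Module.Free ℚ (∀ i, Matrix (Fin 2) (Fin 2) (K i)) := inferInstance
    haveI : Module.Finite ℚ ((∀ i, Matrix (Fin 2) (Fin 2) (K i)) × (∀ j, Matrix (Fin 2) (Fin 2)
        (IntermediateField.adjoin ℚ {zetaOf (lev₂ j) (F j) - (zetaOf (lev₂ j) (F j))⁻¹}))) := inferInstance
    haveI : Module.Free ℚ ((∀ i, Matrix (Fin 2) (Fin 2) (K i)) × (∀ j, Matrix (Fin 2) (Fin 2)
        (IntermediateField.adjoin ℚ {zetaOf (lev₂ j) (F j) - (zetaOf (lev₂ j) (F j))⁻¹}))) := inferInstance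
    have hmid : finrank ℚ (∀ i, Matrix (Fin 2) (Fin 2) (K i)) = 4 * ∑ i, Nat.totient (lev₁ i) := by
      rw [Module.finrank_pi_fintype, Finset.mul_sum]
      refine Finset.sum_congr rfl fun i _ => ?_
      rw [Module.finrank_matrix, Fintype.card_fin, hK i]
    have hlast : finrank ℚ (∀ j, Matrix (Fin 2) (Fin 2)
        (IntermediateField.adjoin ℚ {zetaOf (lev₂ j) (F j) - (zetaOf (lev₂ j) (F j))⁻¹})) = 2 * ∑ j, Nat.totient (lev₂ j) := by
      rw [← e₂.toLinearEquiv.finrank_eq, hfrC]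
    rw [e.toLinearEquiv.finrank_eq, Module.finrank_prod, Module.finrank_prod, finrank_eq_two_four_g (K₄ := K₄), hmid, hlast]
    ring
  · have hd₄ : A₄.dim = 1 := by
      have h : A₄.dim = finrank ℚ K₄ / 2 := Motives.schemeDim_eq_holds hA₄.1
      rw [finrank_eq_two_four_g (K₄ := K₄)] at h
      simpa using h
    have hpair : ∀ i, (⨁ fun l : Fin 2 => (![A i, A' i] : Fin 2 → AbelianVariety ℂ) l).dim = Nat.totient (lev₁ i) := fun i =>
      dim_pair_odd_twiceOdd (ho i).1 (ho i).2 (hΦ i) (hA i) (hΦL i) (hA' i)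
    rw [AbelianVariety.dim_biproduct, Fin.sum_univ_three]
    show 2 * (A₄.dim + (⨁ fun i => ⨁ fun l : Fin 2 => (![A i, A' i] : Fin 2 → AbelianVariety ℂ) l).dim + (⨁ C).dim) =
      2 + 2 * ∑ i, Nat.totient (lev₁ i) + ∑ j, Nat.totient (lev₂ j)
    rw [AbelianVariety.dim_biproduct (fun i => ⨁ fun l : Fin 2 => (![A i, A' i] : Fin 2 → AbelianVariety ℂ) l),
      Finset.sum_congr rfl fun i _ => hpair i, hd₄]
    omega

/-! ## §3 The case `M = 1`: the 2-power levels `m = 2^k`, `k ≥ 3` — `End⁰(J_m) ≅ ℚ(i) × ∏_{8 ≤ e ∣ m} Mat₂(ℚ(ζ_e − ζ_e⁻¹))` -/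

/-- The product of two algebras indexed by `Fin 2`. [folklore] -/
private theorem nonempty_pi_fin_two_algEquiv_prod_g (T : Fin 2 → Type) [∀ i, Ring (T i)] [∀ i, Algebra ℚ (T i)] :
    Nonempty ((∀ i, T i) ≃ₐ[ℚ] T 0 × T 1) := by
  refine ⟨AlgEquiv.ofBijective ((Pi.evalAlgHom ℚ T 0).prod (Pi.evalAlgHom ℚ T 1)) ⟨fun f g h => ?_, fun x => ?_⟩⟩
  · simp only [AlgHom.prod_apply, Pi.evalAlgHom_apply, Prod.mk.injEq] at h
    funext i
    match i with
    | ⟨0, _⟩ => exact h.1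
    | ⟨1, _⟩ => exact h.2
  · exact ⟨Fin.cons x.1 (Fin.cons x.2 finZeroElim), rfl⟩

/-- **`X_4 ⟂ ⨁_j X_{e_j}`** for distinct non-exceptional levels `4 ∣ e_j ≥ 8`, `e_j ≠ 12` (the two parts of `J_{2^k}`, `k ≥ 3`).
[cite: GalleseGoodsonLombardo2024, §3 Thm. 3.0 (last statement)] [cite: MilneCM2006, Ch. I §3 Prop. 3.13] -/
theorem hom_eq_zero_blocks_twoPower (hA₄ : IsCMTypeRealisation Φ₄ A₄ ι₄ θ₄) (h4 : ∀ j, 4 ∣ lev₂ j) (h8 : ∀ j, 8 ≤ lev₂ j)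
    (h12 : ∀ j, lev₂ j ≠ 12) (h20 : ∀ j, lev₂ j ≠ 20) (h24 : ∀ j, lev₂ j ≠ 24) (h60 : ∀ j, lev₂ j ≠ 60)
    (hΨ : ∀ j (σ : F j →+* ℂ), σ ∈ (Ψ j).1 ↔ 2 * (expOf (lev₂ j) (F j) σ).val < lev₂ j)
    (hC : ∀ j, IsCMTypeRealisation (Ψ j) (C j) (ιC j) (θC j)) :
    ∀ a b : Fin 2, a ≠ b →
      ∀ f : (![A₄, ⨁ C] : Fin 2 → AbelianVariety ℂ) a ⟶ (![A₄, ⨁ C] : Fin 2 → AbelianVariety ℂ) b, f = 0 := by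
  classical
  have o4C : ∀ j, (∀ u : A₄ ⟶ C j, u = 0) ∧ (∀ v : C j ⟶ A₄, v = 0) := fun j =>
    let h := orthogonal_four_fourDvd_of_ne_twelve hA₄ (h4 j) (h8 j) (h12 j) (h20 j) (h24 j) (h60 j) (hΨ j) (hC j)
    ⟨h.1, h.2.1⟩
  have b02 : (∀ u : A₄ ⟶ ⨁ C, u = 0) ∧ (∀ v : (⨁ C) ⟶ A₄, v = 0) :=
    ⟨fun u => hom_to_biproduct_eq_zero (fun j w => (o4C j).1 w) u, fun v => hom_from_biproduct_eq_zero (fun j w => (o4C j).2 w) v⟩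
  exact hom_eq_zero_vecCons (X := A₄) (F := (![⨁ C] : Fin 1 → AbelianVariety ℂ)) (Fin.cons b02 finZeroElim) hom_eq_zero_of_fin_one

/-- **GGL THM. 3.0 + LEMMA 14 at a 2-power level `m = 2^k`, `k ≥ 3` (family form, `M = 1`):
`End⁰(J_m) ≃ₐ[ℚ] ℚ(ζ_4) × ∏_j Mat₂(ℚ(ζ_{e_j} − ζ_{e_j}⁻¹))`** on the carrier `![A₄, ⨁_j C_j]` (reading: `e_j = 8, 16, …, 2^k`).
[cite: GalleseGoodsonLombardo2024, §3.5 Lemma 14 (2) and the sentence following it; §3 Thm. 3.0 (5), last statement]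
[cite: MumfordAV1970, §19 Cor. 2 of Thm. 3 and p. 174] [cite: Shimura1998, §5.1 Prop. 3 (proof) and Prop. 6] -/
theorem nonempty_endAlgebra_algEquiv_twoPower (hA₄ : IsCMTypeRealisation Φ₄ A₄ ι₄ θ₄) (h4 : ∀ j, 4 ∣ lev₂ j) (h8 : ∀ j, 8 ≤ lev₂ j)
    (h12 : ∀ j, lev₂ j ≠ 12) (h20 : ∀ j, lev₂ j ≠ 20) (h24 : ∀ j, lev₂ j ≠ 24) (h60 : ∀ j, lev₂ j ≠ 60)
    (hinj₂ : Function.Injective lev₂) (hΨ : ∀ j (σ : F j →+* ℂ), σ ∈ (Ψ j).1 ↔ 2 * (expOf (lev₂ j) (F j) σ).val < lev₂ j)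
    (hC : ∀ j, IsCMTypeRealisation (Ψ j) (C j) (ιC j) (θC j)) :
    Nonempty ((⨁ fun a : Fin 2 => (![A₄, ⨁ C] : Fin 2 → AbelianVariety ℂ) a).endAlgebra ≃ₐ[ℚ]
      K₄ × (∀ j, Matrix (Fin 2) (Fin 2) (IntermediateField.adjoin ℚ {zetaOf (lev₂ j) (F j) - (zetaOf (lev₂ j) (F j))⁻¹}))) := by
  classical
  obtain ⟨E, -⟩ := AbelianVariety.nonempty_algEquiv_endAlgebra_biproduct_pi (A := fun a : Fin 2 => (![A₄, ⨁ C] : Fin 2 → AbelianVariety ℂ) a)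
    (hom_eq_zero_blocks_twoPower hA₄ h4 h8 h12 h20 h24 h60 hΨ hC)
  obtain ⟨P⟩ := nonempty_pi_fin_two_algEquiv_prod_g (fun a : Fin 2 => ((![A₄, ⨁ C] : Fin 2 → AbelianVariety ℂ) a).endAlgebra)
  obtain ⟨e₀⟩ : Nonempty (A₄.endAlgebra ≃ₐ[ℚ] K₄) :=
    hA₄.nonempty_endAlgebra_algEquiv_of_primitive (CMTypeLattice.primitive_of_finrank_eq_two Φ₄ finrank_eq_two_four_g)
  obtain ⟨e₂⟩ := nonempty_endAlgebra_biproduct_algEquiv_pi_fourDvd h4 h8 h20 h24 h60 hinj₂ hΨ hC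
  exact ⟨(E.trans P).trans (AlgEquiv.prodCongr e₀ e₂)⟩

/-- **Dimension count at a 2-power level: `dim_ℚ End⁰(J) = 2 + 2 Σ_j φ(e_j)`, `2 dim J = 2 + Σ_j φ(e_j)`** (for `J_{2^k}`: `2^{k+1} − 6` and
`2^k − 2`). [cite: GalleseGoodsonLombardo2024, §3 Thm. 3.0 («dim X_d = φ(d)/2») and §3.5 Lemma 14 (2)] [cite: MumfordAV1970, §19 Cor. 2 of Thm. 3] -/
theorem finrank_endAlgebra_twoPower (hA₄ : IsCMTypeRealisation Φ₄ A₄ ι₄ θ₄) (h4 : ∀ j, 4 ∣ lev₂ j) (h8 : ∀ j, 8 ≤ lev₂ j)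
    (h12 : ∀ j, lev₂ j ≠ 12) (h20 : ∀ j, lev₂ j ≠ 20) (h24 : ∀ j, lev₂ j ≠ 24) (h60 : ∀ j, lev₂ j ≠ 60)
    (hinj₂ : Function.Injective lev₂) (hΨ : ∀ j (σ : F j →+* ℂ), σ ∈ (Ψ j).1 ↔ 2 * (expOf (lev₂ j) (F j) σ).val < lev₂ j)
    (hC : ∀ j, IsCMTypeRealisation (Ψ j) (C j) (ιC j) (θC j)) :
    finrank ℚ (⨁ fun a : Fin 2 => (![A₄, ⨁ C] : Fin 2 → AbelianVariety ℂ) a).endAlgebra = 2 + 2 * ∑ j, Nat.totient (lev₂ j) ∧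
    2 * (⨁ fun a : Fin 2 => (![A₄, ⨁ C] : Fin 2 → AbelianVariety ℂ) a).dim = 2 + ∑ j, Nat.totient (lev₂ j) := by
  classical
  obtain ⟨hfrC, hdimC⟩ := finrank_endAlgebra_biproduct_fourDvd h4 h8 h20 h24 h60 hinj₂ hΨ hC
  refine ⟨?_, ?_⟩
  · obtain ⟨e⟩ := nonempty_endAlgebra_algEquiv_twoPower hA₄ h4 h8 h12 h20 h24 h60 hinj₂ hΨ hC
    obtain ⟨e₂⟩ := nonempty_endAlgebra_biproduct_algEquiv_pi_fourDvd h4 h8 h20 h24 h60 hinj₂ hΨ hC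
    haveI : ∀ j, FiniteDimensional ℚ (IntermediateField.adjoin ℚ {zetaOf (lev₂ j) (F j) - (zetaOf (lev₂ j) (F j))⁻¹}) := fun j =>
      IntermediateField.finiteDimensional_left _
    haveI : ∀ j, Module.Finite ℚ (Matrix (Fin 2) (Fin 2)
        (IntermediateField.adjoin ℚ {zetaOf (lev₂ j) (F j) - (zetaOf (lev₂ j) (F j))⁻¹})) := fun j => Module.Finite.matrix
    haveI : ∀ j, Module.Free ℚ (Matrix (Fin 2) (Fin 2)
        (IntermediateField.adjoin ℚ {zetaOf (lev₂ j) (F j) - (zetaOf (lev₂ j) (F j))⁻¹})) := fun j => inferInstance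
    haveI : Module.Finite ℚ (∀ j, Matrix (Fin 2) (Fin 2)
        (IntermediateField.adjoin ℚ {zetaOf (lev₂ j) (F j) - (zetaOf (lev₂ j) (F j))⁻¹})) := inferInstance
    haveI : Module.Free ℚ (∀ j, Matrix (Fin 2) (Fin 2)
        (IntermediateField.adjoin ℚ {zetaOf (lev₂ j) (F j) - (zetaOf (lev₂ j) (F j))⁻¹})) := inferInstance
    have hlast : finrank ℚ (∀ j, Matrix (Fin 2) (Fin 2)
        (IntermediateField.adjoin ℚ {zetaOf (lev₂ j) (F j) - (zetaOf (lev₂ j) (F j))⁻¹})) = 2 * ∑ j, Nat.totient (lev₂ j) := by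
      rw [← e₂.toLinearEquiv.finrank_eq, hfrC]
    rw [e.toLinearEquiv.finrank_eq, Module.finrank_prod, finrank_eq_two_four_g (K₄ := K₄), hlast]
  · have hd₄ : A₄.dim = 1 := by
      have h : A₄.dim = finrank ℚ K₄ / 2 := Motives.schemeDim_eq_holds hA₄.1
      rw [finrank_eq_two_four_g (K₄ := K₄)] at h
      simpa using h
    rw [AbelianVariety.dim_biproduct, Fin.sum_univ_two]
    show 2 * (A₄.dim + (⨁ C).dim) = 2 + ∑ j, Nat.totient (lev₂ j)
    rw [hd₄]
    omega

end GenericComposite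

end HyperellipticJacobian

end Literature.AlgebraicGeometry.ComplexMultiplication

end
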